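import Literature.NumberTheory.EllipticCurves.IwasawaEulerCharProofs
import Mathlib.NumberTheory.Padics.RingHoms
import Mathlib.Data.Nat.Factorization.Basic
import HarnessLib

/-!
# Finite `Λ`-submodules and the `Γ`-invariants `M[T]`: Kitajima–Otsuki's Lemma 3.30 (2)
# (NSW 5.3.19) and Greenberg's lemma (LNM 1716 pp. 104–105 = Kitajima–Otsuki Prop. 4.7), PROVED

`Proofs` file (theorems only; no definition, no named fact, `#print axioms` standard) over the Iwasawa
algebra `Λ = ℤ_p⟦T⟧` (`IwasawaAlgebra p`) and the tree's `invariants p M = M[T]`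
(`IwasawaEulerCharProofs`). The two algebraic tools by which Kitajima–Otsuki (Tokyo J. Math. 41 (2018)
§3.3–§4.2) make the absence of finite `Λ`-submodules pass from one Iwasawa module to another:

* Lemma 3.30 (2) [NSW Prop. 5.3.19 (ii)]: "**`M` has no nontrivial finite `Λ`-submodule if and only if
  `M^Γ` is a free `ℤ_p`-module**" — here for `M[T] = M^Γ` in the form "`M[T]` has no `p`-power torsion"
  (a finitely generated `ℤ_p`-module is free iff torsion-free; for the forward direction `M` is
  finitely generated): `forall_finite_eq_bot_of_forall_pow_smul_invariants_eq_zero` (⟸) and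
  `pow_smul_eq_zero_invariants_of_forall_finite_eq_bot` (⟹);
* Prop. 4.7 [Greenberg 1999 pp. 104–105]: "**Let `f : M → N` be an injective homomorphism of
  `Λ`-modules. Suppose that `N` is finitely generated with no nontrivial finite `Λ`-submodule and that
  `M` is free. Then `Coker f` has no nontrivial finite `Λ`-submodule**" — here with the two properties
  of a free module that the proof uses DISPLAYED as hypotheses on the source `F` (`X` is injective on
  `F`; `F/XF` has no `p`-torsion: `p^k a = X b ⟹ X ∣ a`), which `Λ` itself and every `ι → Λ` satisfy
  (`X_smul_injective_pi`, `exists_eq_X_smul_of_pow_smul_eq_X_smul_pi`):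
  `forall_finite_eq_bot_quotient_range`.

Ingredients, all elementary: a finite `Λ`-module is killed by a power of `p` (its order is `p^k·m`
with `p ∤ m`, and `m` is a unit of `ℤ_p`); on a finite submodule `N ≠ 0` the endomorphism `X` is not
injective (else it is onto, `N = X·N`, and Nakayama with `X ∈ 𝔪_Λ` gives `N = 0`), so `N ∩ M[T] ≠ 0`;
conversely for `x ∈ M[T]` with `p^k x = 0` the cyclic module `Λ·x = {a·x : a < p^k}` is finite
(`f·x = f(0)·x` and `f(0) ≡ appr f(0) k (mod p^k)`, Mathlib `PadicInt.appr_spec`).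

Use: the Selmer-side inheritance arguments of the BSD cell (`b2b-bsdres`: X12 / O10 strict signed
Selmer groups, x1b GEN 44; n1011 non-primitive duals) — nothing about any Selmer group is stated here.

References: [KitajimaOtsuki2018] T. Kitajima, R. Otsuki, Tokyo J. Math. 41 (2018), Lemma 3.30, Lemma 3.31,
Prop. 4.7 (arXiv:1607.03612 pp. 17, 19); [NeukirchSchmidtWingberg2008] Prop. 5.3.19; [GreenbergLNM1716]
R. Greenberg, LNM 1716 (1999), pp. 104–105; [Washington1997] §13.2 (Nakayama over `Λ`).
-/

noncomputable section

open scoped Classical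

universe u

namespace Literature.NumberTheory.EllipticCurves.IwasawaAlgebra

variable (p : ℕ) [hp : Fact p.Prime]

/-! ## §1 Elementary facts: `X ∈ 𝔪_Λ`, finite modules are `p`-power torsion, Nakayama on finite submodules -/

/-- `X` lies in the maximal ideal of the local ring `Λ = ℤ_p⟦T⟧` (its constant term is `0`).
[cite: Washington1997, §13.2] -/
theorem X_mem_maximalIdeal' :
    (PowerSeries.X : IwasawaAlgebra p) ∈ IsLocalRing.maximalIdeal (IwasawaAlgebra p) := by
  rw [IsLocalRing.mem_maximalIdeal, mem_nonunits_iff, PowerSeries.isUnit_iff_constantCoeff]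
  simp

section Module

variable {M : Type u} [AddCommGroup M] [Module (IwasawaAlgebra p) M]

/-- A natural number prime to `p` acts invertibly on a `Λ`-module: `m • x = 0 ⟹ x = 0` for `p ∤ m`
(`m` is a unit of `ℤ_p ⊂ Λ`). [folklore] -/
private theorem eq_zero_of_nsmul_eq_zero_of_not_dvd {m : ℕ} (hm : ¬ p ∣ m) {x : M} (hx : m • x = 0) : x = 0 := by
  have hnorm : ‖((m : ℤ) : ℤ_[p])‖ = 1 := by
    have hle := PadicInt.norm_le_one ((m : ℤ) : ℤ_[p])
    have hlt : ¬ ‖((m : ℤ) : ℤ_[p])‖ < 1 := by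
      rw [PadicInt.norm_int_lt_one_iff_dvd]
      exact_mod_cast hm
    exact le_antisymm hle (not_lt.mp hlt)
  have hunit : IsUnit ((m : ℤ) : ℤ_[p]) := PadicInt.isUnit_iff.mpr hnorm
  obtain ⟨u, hu⟩ := hunit
  have hC : IsUnit (PowerSeries.C ((m : ℤ) : ℤ_[p]) : IwasawaAlgebra p) := by
    rw [← hu]; exact (Units.map (PowerSeries.C (R := ℤ_[p])).toMonoidHom u).isUnit
  have hmx : (PowerSeries.C ((m : ℤ) : ℤ_[p]) : IwasawaAlgebra p) • x = 0 := by
    rw [Int.cast_natCast, map_natCast, Nat.cast_smul_eq_nsmul]; exact hx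
  obtain ⟨v, hv⟩ := hC
  have := congrArg (fun y ↦ ((v⁻¹ : (IwasawaAlgebra p)ˣ) : IwasawaAlgebra p) • y) hmx
  simp only [smul_zero] at this
  rw [← hv, smul_smul, Units.inv_mul, one_smul] at this
  exact this

/-- **A finite `Λ`-module is `p`-power torsion**: every element of a finite `Λ`-submodule is killed by
a power of `p` (its additive order divides `#N = p^k·m` with `p ∤ m`, and `m` acts invertibly).
[folklore] -/
private theorem exists_pow_smul_eq_zero_of_finite (N : Submodule (IwasawaAlgebra p) M) [Finite N] :
    ∃ k : ℕ, ∀ x ∈ N, (p ^ k : ℕ) • x = 0 := by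
  have hcard : Nat.card N ≠ 0 := Nat.card_pos.ne'
  obtain ⟨k, m, hm, hkm⟩ := Nat.exists_eq_pow_mul_and_not_dvd hcard p hp.out.one_lt.ne'
  refine ⟨k, fun x hx ↦ ?_⟩
  have h1 : Nat.card N • (⟨x, hx⟩ : N) = 0 := by
    rw [← addOrderOf_dvd_iff_nsmul_eq_zero]; exact addOrderOf_dvd_natCard _
  rw [hkm, mul_nsmul] at h1
  have h2 : m • ((p ^ k : ℕ) • x) = 0 := by
    have := congrArg Subtype.val h1
    simpa using this
  exact eq_zero_of_nsmul_eq_zero_of_not_dvd p hm h2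

/-- **Nakayama on a finite submodule**: if `N ≤ X·N` for a finite `Λ`-submodule `N`, then `N = 0`
(`N` is finitely generated and `X ∈ 𝔪_Λ ⊆ Jac(Λ)`). [cite: Washington1997, §13.2 (Nakayama's lemma)] -/
theorem eq_bot_of_le_X_smul_of_finite (N : Submodule (IwasawaAlgebra p) M) [Finite N]
    (h : N ≤ (Ideal.span {(PowerSeries.X : IwasawaAlgebra p)}) • N) : N = ⊥ := by
  refine Submodule.eq_bot_of_le_smul_of_le_jacobson_bot _ N ?_ h ?_
  · exact Module.Finite.iff_fg.mp (Module.Finite.of_finite)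
  · exact le_trans ((Ideal.span_singleton_le_iff_mem _).mpr (X_mem_maximalIdeal' p))
      (IsLocalRing.maximalIdeal_le_jacobson _)

/-- **On a non-zero finite `Λ`-submodule, `X` has a kernel**: some `x ≠ 0` in `N` lies in
`M[T] = invariants p M` (if `X` were injective on the finite set `N` it would be onto, `N ≤ X·N`, and
Nakayama would give `N = 0`). [cite: KitajimaOtsuki2018, Lemma 3.30 (proof, via NSW 5.3.19)] -/
theorem exists_ne_zero_mem_invariants_of_finite_ne_bot (N : Submodule (IwasawaAlgebra p) M) [Finite N]
    (hN : N ≠ ⊥) : ∃ x ∈ N, x ≠ 0 ∧ x ∈ invariants p M := by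
  by_contra hcon
  -- `X` is injective on `N`
  let φ : N → N := fun x ↦ ⟨(PowerSeries.X : IwasawaAlgebra p) • (x : M), N.smul_mem _ x.2⟩
  have hinj : Function.Injective φ := by
    intro a b hab
    have h0 : (PowerSeries.X : IwasawaAlgebra p) • ((a : M) - b) = 0 := by
      rw [smul_sub, sub_eq_zero]; exact congrArg Subtype.val hab
    by_contra hne
    have hne' : (a : M) - b ≠ 0 := sub_ne_zero.mpr fun h ↦ hne (Subtype.ext h)
    exact hcon ⟨_, N.sub_mem a.2 b.2, hne', (mem_invariants_iff p M _).mpr h0⟩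
  -- hence onto: `N ≤ X·N`
  have hsurj : Function.Surjective φ := Finite.surjective_of_injective hinj
  apply hN
  refine eq_bot_of_le_X_smul_of_finite p N fun x hx ↦ ?_
  obtain ⟨y, hy⟩ := hsurj ⟨x, hx⟩
  have : x = (PowerSeries.X : IwasawaAlgebra p) • (y : M) := (congrArg Subtype.val hy).symm
  rw [this]
  exact Submodule.smul_mem_smul (Ideal.mem_span_singleton_self _) y.2

/-! ## §2 Kitajima–Otsuki Lemma 3.30 (2) / NSW 5.3.19 (ii): no finite submodule ⟺ `M[T]` is `p`-torsion-free -/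

/-- **(⟸) If `M[T]` has no `p`-power torsion then `M` has no non-zero finite `Λ`-submodule** (any
`Λ`-module `M`): a finite `N ≠ 0` contains some `x ≠ 0` of `M[T]` (previous lemma) which is killed by
a power of `p` (finite modules are `p`-power torsion). [cite: KitajimaOtsuki2018, Lemma 3.30 (2)]
[cite: NeukirchSchmidtWingberg2008, Prop. 5.3.19 (ii)] -/
theorem forall_finite_eq_bot_of_forall_pow_smul_invariants_eq_zero
    (htf : ∀ x ∈ invariants p M, ∀ k : ℕ, (p ^ k : ℕ) • x = 0 → x = 0) :
    ∀ N : Submodule (IwasawaAlgebra p) M, Finite N → N = ⊥ := by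
  intro N hN
  by_contra hne
  obtain ⟨x, hxN, hx0, hxT⟩ := exists_ne_zero_mem_invariants_of_finite_ne_bot p N hne
  obtain ⟨k, hk⟩ := exists_pow_smul_eq_zero_of_finite p N
  exact hx0 (htf x hxT k (hk x hxN))

/-- On `M[T]` the algebra `Λ` acts through constant terms: `f • x = f(0) • x` for `X • x = 0`
(`f = f(0) + X·g`). [folklore] -/
private theorem smul_eq_C_constantCoeff_smul_of_mem_invariants {x : M} (hx : x ∈ invariants p M)
    (f : IwasawaAlgebra p) : f • x = (PowerSeries.C (PowerSeries.constantCoeff f) : IwasawaAlgebra p) • x := by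
  have hf : f = PowerSeries.X * PowerSeries.mk (fun n ↦ PowerSeries.coeff (n + 1) f) +
      PowerSeries.C (PowerSeries.constantCoeff f) := PowerSeries.eq_X_mul_shift_add_const f
  conv_lhs => rw [hf]
  rw [add_smul, mul_comm, mul_smul, (mem_invariants_iff p M x).mp hx, smul_zero, zero_add]

/-- **(⟹) If `M` is finitely generated with no non-zero finite `Λ`-submodule then `M[T]` has no
`p`-power torsion**: for `x ∈ M[T]` with `p^k x = 0` the cyclic submodule `Λ·x` is finite — every
`f • x = f(0) • x = (appr f(0) k) • x`, `f(0) − appr f(0) k ∈ p^k ℤ_p` — hence zero.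
[cite: KitajimaOtsuki2018, Lemma 3.30 (2)] [cite: NeukirchSchmidtWingberg2008, Prop. 5.3.19 (ii)] -/
theorem pow_smul_eq_zero_invariants_of_forall_finite_eq_bot
    (hnf : ∀ N : Submodule (IwasawaAlgebra p) M, Finite N → N = ⊥)
    {x : M} (hx : x ∈ invariants p M) {k : ℕ} (hk : (p ^ k : ℕ) • x = 0) : x = 0 := by
  -- every element of `Λ·x` is `a • x` with `a < p^k`
  have hrep : ∀ y ∈ Submodule.span (IwasawaAlgebra p) ({x} : Set M), ∃ a : Fin (p ^ k), y = (a : ℕ) • x := by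
    intro y hy
    obtain ⟨f, rfl⟩ := Submodule.mem_span_singleton.mp hy
    set c : ℤ_[p] := PowerSeries.constantCoeff f with hc
    have h1 : f • x = (PowerSeries.C c : IwasawaAlgebra p) • x :=
      smul_eq_C_constantCoeff_smul_of_mem_invariants p hx f
    -- `c = appr c k + p^k d`
    have happr := PadicInt.appr_spec k c
    obtain ⟨d, hd⟩ := Ideal.mem_span_singleton.mp happr
    have hpk : p ^ k ≠ 0 := pow_ne_zero k hp.out.ne_zero
    have hc' : c = ((PadicInt.appr c k : ℕ) : ℤ_[p]) + (p : ℤ_[p]) ^ k * d := by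
      rw [← hd]; ring
    have hpkx : (PowerSeries.C ((p : ℤ_[p]) ^ k) : IwasawaAlgebra p) • x = 0 := by
      rw [map_pow, map_natCast, ← Nat.cast_pow, Nat.cast_smul_eq_nsmul]; exact hk
    have key : (PowerSeries.C c : IwasawaAlgebra p) • x = (PadicInt.appr c k) • x := by
      calc (PowerSeries.C c : IwasawaAlgebra p) • x
          = (PowerSeries.C (((PadicInt.appr c k : ℕ) : ℤ_[p]) + (p : ℤ_[p]) ^ k * d) : IwasawaAlgebra p) • x := by
            rw [← hc']
        _ = (PadicInt.appr c k) • x +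
              (PowerSeries.C d : IwasawaAlgebra p) • ((PowerSeries.C ((p : ℤ_[p]) ^ k) : IwasawaAlgebra p) • x) := by
            rw [map_add, add_smul, map_mul, mul_comm, mul_smul, map_natCast, Nat.cast_smul_eq_nsmul]
        _ = (PadicInt.appr c k) • x := by rw [hpkx, smul_zero, add_zero]
    refine ⟨⟨PadicInt.appr c k % p ^ k, Nat.mod_lt _ (Nat.pos_of_ne_zero hpk)⟩, ?_⟩
    show f • x = (PadicInt.appr c k % p ^ k) • x
    rw [h1, key]
    conv_lhs => rw [← Nat.mod_add_div (PadicInt.appr c k) (p ^ k)]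
    rw [add_nsmul, mul_nsmul, hk, nsmul_zero, add_zero]
  haveI : Finite (Submodule.span (IwasawaAlgebra p) ({x} : Set M)) := by
    refine Finite.of_surjective (fun a : Fin (p ^ k) ↦ (⟨(a : ℕ) • x,
      Submodule.smul_of_tower_mem _ _ (Submodule.mem_span_singleton_self x)⟩ :
        Submodule.span (IwasawaAlgebra p) ({x} : Set M))) ?_
    rintro ⟨y, hy⟩
    obtain ⟨a, ha⟩ := hrep y hy
    exact ⟨a, Subtype.ext ha.symm⟩
  have hbot := hnf _ this
  rw [Submodule.span_singleton_eq_bot] at hbot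
  exact hbot

/-! ## §3 Greenberg's lemma (Kitajima–Otsuki Prop. 4.7): free ↪ no-finite ⟹ the cokernel has no finite submodule -/

/-- **Greenberg's lemma.** Let `f : F → N` be an injective `Λ`-linear map, `N` with no non-zero finite
`Λ`-submodule, and `F` "free-like": `X` injective on `F` and `F/XF` without `p`-torsion (`p^k a = X b ⟹
a ∈ XF`) — both hold for free modules. Then `N ⧸ f(F)` has no non-zero finite `Λ`-submodule. Proof
(Greenberg pp. 104–105 / Kitajima–Otsuki Prop. 4.7 via Lemma 3.30): for `x̄ ∈ (N/F)[T]` with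
`p^k x̄ = 0` one has `X x = f a`, `p^k x = f b`, whence `p^k a = X b` in `F`, `a = X a'`, `y := x − f a' ∈
N[T]` with `p^k y = f(b − p^k a')` and `X(b − p^k a') = 0`, so `p^k y = 0`, `y = 0` by §2 (⟹) for `N`,
and `x̄ = ȳ = 0`; conclude by §2 (⟸). [cite: GreenbergLNM1716, pp. 104–105] [cite: KitajimaOtsuki2018, Prop. 4.7 and Lemma 3.31] -/
theorem forall_finite_eq_bot_quotient_range
    {N : Type u} [AddCommGroup N] [Module (IwasawaAlgebra p) N]
    {F : Type u} [AddCommGroup F] [Module (IwasawaAlgebra p) F]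
    (hnf : ∀ N' : Submodule (IwasawaAlgebra p) N, Finite N' → N' = ⊥)
    (f : F →ₗ[IwasawaAlgebra p] N) (hf : Function.Injective f)
    (hFX : ∀ a : F, (PowerSeries.X : IwasawaAlgebra p) • a = 0 → a = 0)
    (hFp : ∀ (a b : F) (k : ℕ), (p ^ k : ℕ) • a = (PowerSeries.X : IwasawaAlgebra p) • b →
      ∃ a' : F, a = (PowerSeries.X : IwasawaAlgebra p) • a') :
    ∀ Q : Submodule (IwasawaAlgebra p) (N ⧸ LinearMap.range f), Finite Q → Q = ⊥ := by
  refine forall_finite_eq_bot_of_forall_pow_smul_invariants_eq_zero p fun xbar hxbar k hk ↦ ?_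
  obtain ⟨x, rfl⟩ := Submodule.Quotient.mk_surjective (LinearMap.range f) xbar
  -- `X x = f a`, `p^k x = f b`
  have hXx : (PowerSeries.X : IwasawaAlgebra p) • x ∈ LinearMap.range f := by
    rw [← Submodule.Quotient.mk_eq_zero, Submodule.Quotient.mk_smul]
    exact (mem_invariants_iff p _ _).mp hxbar
  have hpx : (p ^ k : ℕ) • x ∈ LinearMap.range f := by
    rw [← Submodule.Quotient.mk_eq_zero, Submodule.Quotient.mk_smul]
    exact hk
  obtain ⟨a, ha⟩ := LinearMap.mem_range.mp hXx
  obtain ⟨b, hb⟩ := LinearMap.mem_range.mp hpx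
  -- `p^k a = X b` in `F`
  have hab : (p ^ k : ℕ) • a = (PowerSeries.X : IwasawaAlgebra p) • b := by
    apply hf
    rw [map_nsmul, map_smul, ha, hb, smul_comm]
  obtain ⟨a', rfl⟩ := hFp a b k hab
  -- `y := x − f a' ∈ N[T]`, `p^k y = 0`
  set y : N := x - f a' with hy
  have hyT : (PowerSeries.X : IwasawaAlgebra p) • y = 0 := by
    rw [hy, smul_sub, ← map_smul, ha, sub_self]
  have hb' : (PowerSeries.X : IwasawaAlgebra p) • (b - (p ^ k : ℕ) • a') = 0 := by
    apply hf
    rw [map_zero, map_smul, map_sub, map_nsmul, hb, ← nsmul_sub, smul_comm]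
    -- `p^k • X • (x - f a') = p^k • X • y = 0`
    have : (PowerSeries.X : IwasawaAlgebra p) • (x - f a') = 0 := hyT
    rw [this, nsmul_zero]
  have hb'' : b = (p ^ k : ℕ) • a' := sub_eq_zero.mp (hFX _ hb')
  have hpy : (p ^ k : ℕ) • y = 0 := by
    show (p ^ k : ℕ) • (x - f a') = 0
    rw [nsmul_sub, ← hb, hb'', map_nsmul, sub_self]
  have hy0 : y = 0 :=
    pow_smul_eq_zero_invariants_of_forall_finite_eq_bot p hnf ((mem_invariants_iff p N y).mpr hyT) hpy
  -- `x̄ = ȳ = 0`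
  have : Submodule.Quotient.mk (p := LinearMap.range f) x = Submodule.Quotient.mk y := by
    rw [hy, Submodule.Quotient.mk_sub, (Submodule.Quotient.mk_eq_zero _).mpr (LinearMap.mem_range_self f a'),
      sub_zero]
  rw [this, hy0, Submodule.Quotient.mk_zero]

end Module

/-! ## §4 The free modules `Λ` and `ι → Λ` satisfy the two displayed hypotheses -/

/-- `X` is injective on the free module `ι → Λ` (`Λ` is a domain) — the `M^Γ = 0` half of
Kitajima–Otsuki's Lemma 3.30 (1) "`M` is free iff `M^Γ = 0` and `M_Γ` is `ℤ_p`-free" for `M = Λ^ι`.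
[cite: KitajimaOtsuki2018, Lemma 3.30 (1) (arXiv:1607.03612 p. 17)] -/
theorem X_smul_injective_pi {ι : Type*} (a : ι → IwasawaAlgebra p)
    (h : (PowerSeries.X : IwasawaAlgebra p) • a = 0) : a = 0 := by
  funext i
  have := congrFun h i
  simp only [Pi.smul_apply, smul_eq_mul, Pi.zero_apply, mul_eq_zero, PowerSeries.X_ne_zero, false_or] at this
  exact this

/-- `(ι → Λ)/X(ι → Λ)` has no `p`-torsion: `p^k a = X b ⟹ a = X a'` (compare constant terms:
`p^k a_i(0) = 0`, so `a_i(0) = 0` and `X ∣ a_i`) — the `M_Γ` `ℤ_p`-free half of Kitajima–Otsuki's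
Lemma 3.30 (1) for the free module `M = Λ^ι`. [cite: KitajimaOtsuki2018, Lemma 3.30 (1) (arXiv:1607.03612 p. 17)] -/
theorem exists_eq_X_smul_of_pow_smul_eq_X_smul_pi {ι : Type*} (a b : ι → IwasawaAlgebra p) (k : ℕ)
    (h : (p ^ k : ℕ) • a = (PowerSeries.X : IwasawaAlgebra p) • b) :
    ∃ a' : ι → IwasawaAlgebra p, a = (PowerSeries.X : IwasawaAlgebra p) • a' := by
  have hdiv : ∀ i, (PowerSeries.X : IwasawaAlgebra p) ∣ a i := fun i ↦ by
    have hi := congrFun h i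
    simp only [Pi.smul_apply, smul_eq_mul] at hi
    rw [PowerSeries.X_dvd_iff]
    have hc := congrArg PowerSeries.constantCoeff hi
    rw [nsmul_eq_mul, map_mul, map_mul, PowerSeries.constantCoeff_X, zero_mul, map_natCast] at hc
    have hpk : ((p ^ k : ℕ) : ℤ_[p]) ≠ 0 := by exact_mod_cast pow_ne_zero k hp.out.ne_zero
    exact (mul_eq_zero.mp hc).resolve_left hpk
  choose a' ha' using hdiv
  exact ⟨a', funext fun i ↦ by rw [Pi.smul_apply, smul_eq_mul]; exact ha' i⟩

/-- **Greenberg's lemma for a free source `ι → Λ`**: if `N` has no non-zero finite `Λ`-submodule and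
`f : (ι → Λ) → N` is injective and `Λ`-linear, then `N ⧸ f(ι → Λ)` has no non-zero finite
`Λ`-submodule. [cite: GreenbergLNM1716, pp. 104–105] [cite: KitajimaOtsuki2018, Prop. 4.7] -/
theorem forall_finite_eq_bot_quotient_range_pi {ι : Type} {N : Type} [AddCommGroup N]
    [Module (IwasawaAlgebra p) N]
    (hnf : ∀ N' : Submodule (IwasawaAlgebra p) N, Finite N' → N' = ⊥)
    (f : (ι → IwasawaAlgebra p) →ₗ[IwasawaAlgebra p] N) (hf : Function.Injective f) :
    ∀ Q : Submodule (IwasawaAlgebra p) (N ⧸ LinearMap.range f), Finite Q → Q = ⊥ :=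
  forall_finite_eq_bot_quotient_range p hnf f hf (X_smul_injective_pi p) (exists_eq_X_smul_of_pow_smul_eq_X_smul_pi p)

/-! ## §5 The rank-one inheritance shape (Kitajima–Otsuki Prop. 4.6 + 4.7 + Thm. 4.8, `[k₀ : ℚ_p] = 1`)

(`X` in the universe of `Λ`, `Type`, as the tree's Selmer duals over number fields in `Type` are.) -/

/-- **A `Λ`-linear map `Λ → X` with torsion cokernel into a NON-torsion module is injective**
(Kitajima–Otsuki Prop. 4.6 in rank one: the kernel of `ι` is a torsion submodule of the torsion-free
`Λ`; here: a non-zero kernel ideal `I` makes `ι(Λ) ≅ Λ/I` torsion, and with `X/ι(Λ)` torsion `X` would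
be torsion). [cite: KitajimaOtsuki2018, Prop. 4.6 (arXiv:1607.03612 p. 19)] -/
theorem injective_of_isTorsion_quotient_of_not_isTorsion {X : Type} [AddCommGroup X]
    [Module (IwasawaAlgebra p) X] (ι : IwasawaAlgebra p →ₗ[IwasawaAlgebra p] X)
    (hq : Module.IsTorsion (IwasawaAlgebra p) (X ⧸ LinearMap.range ι))
    (hX : ¬ Module.IsTorsion (IwasawaAlgebra p) X) : Function.Injective ι := by
  rw [← LinearMap.ker_eq_bot, Submodule.eq_bot_iff]
  intro a ha
  by_contra ha0
  apply hX
  intro x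
  -- `x̄` is torsion in `X/ι(Λ)`: `g • x = ι b` for some `g ≠ 0`
  obtain ⟨g, hgx⟩ := @hq (Submodule.Quotient.mk x)
  simp only [Submonoid.smul_def] at hgx
  have hgx' : (g : IwasawaAlgebra p) • x ∈ LinearMap.range ι := by
    rw [← Submodule.Quotient.mk_eq_zero, Submodule.Quotient.mk_smul]; exact hgx
  obtain ⟨b, hb⟩ := LinearMap.mem_range.mp hgx'
  -- `a • ι b = ι (a * b) = b • ι a = 0`, so `(a * g) • x = 0` with `a * g ≠ 0`
  have hab : (a * (g : IwasawaAlgebra p)) • x = 0 := by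
    rw [mul_smul, ← hb, ← map_smul, smul_eq_mul, mul_comm, ← smul_eq_mul, map_smul,
      LinearMap.mem_ker.mp ha, smul_zero]
  have ha' : a ∈ nonZeroDivisors (IwasawaAlgebra p) := mem_nonZeroDivisors_of_ne_zero ha0
  have hmem : a * (g : IwasawaAlgebra p) ∈ nonZeroDivisors (IwasawaAlgebra p) := mul_mem ha' g.2
  refine ⟨⟨a * (g : IwasawaAlgebra p), hmem⟩, ?_⟩
  simp only [Submonoid.smul_def]
  exact hab

/-- **Kitajima–Otsuki's inheritance in rank one (Prop. 4.6 + Prop. 4.7 ⟹ Thm. 4.8, the case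
`[F_{0,v} : ℚ_p] = 1` of one local factor `Λ`).** If `X` has no non-zero finite `Λ`-submodule and is
NOT `Λ`-torsion, and `ι : Λ → X` is `Λ`-linear with `Λ`-torsion cokernel, then the cokernel `X ⧸ ι(Λ)`
has no non-zero finite `Λ`-submodule. In the source: `X = Sel(F_∞, E[p^∞])^∨` (no finite submodule
by Thm. 4.5), `Λ ≅ (H¹(F_{∞,v}, E[p^∞])/E^± ⊗ ℚ_p/ℤ_p)^∨` (Prop. 3.32), the cokernel `X^± = Sel^±^∨`
(torsion by (vi)). [cite: KitajimaOtsuki2018, Thm. 4.8 with Prop. 4.6–4.7 (arXiv:1607.03612 p. 19)] -/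
theorem forall_finite_eq_bot_quotient_range_of_not_isTorsion {X : Type} [AddCommGroup X]
    [Module (IwasawaAlgebra p) X]
    (hnf : ∀ N : Submodule (IwasawaAlgebra p) X, Finite N → N = ⊥)
    (hX : ¬ Module.IsTorsion (IwasawaAlgebra p) X)
    (ι : IwasawaAlgebra p →ₗ[IwasawaAlgebra p] X)
    (hq : Module.IsTorsion (IwasawaAlgebra p) (X ⧸ LinearMap.range ι)) :
    ∀ Q : Submodule (IwasawaAlgebra p) (X ⧸ LinearMap.range ι), Finite Q → Q = ⊥ :=
  forall_finite_eq_bot_quotient_range p hnf ι (injective_of_isTorsion_quotient_of_not_isTorsion p ι hq hX)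
    (fun a h ↦ by
      rw [smul_eq_mul, mul_eq_zero] at h
      exact h.resolve_left PowerSeries.X_ne_zero)
    (fun a b k h ↦ by
      -- `p^k a = X b ⟹ a(0) = 0 ⟹ X ∣ a`
      have hdiv : (PowerSeries.X : IwasawaAlgebra p) ∣ a := by
        rw [PowerSeries.X_dvd_iff]
        rw [smul_eq_mul] at h
        have hc := congrArg PowerSeries.constantCoeff h
        rw [nsmul_eq_mul, map_mul, map_mul, PowerSeries.constantCoeff_X, zero_mul, map_natCast] at hc
        have hpk : ((p ^ k : ℕ) : ℤ_[p]) ≠ 0 := by exact_mod_cast pow_ne_zero k hp.out.ne_zero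
        exact (mul_eq_zero.mp hc).resolve_left hpk
      obtain ⟨a', ha'⟩ := hdiv
      exact ⟨a', by rw [smul_eq_mul]; exact ha'⟩)

end Literature.NumberTheory.EllipticCurves.IwasawaAlgebra

end
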